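import Summits.AtomisticToContinuum.BoseEinsteinCondensation.Theorems.BECThomsonPrincipleGDTransferSeededPlainFormsBdd

/-!
# Route `BECThomsonPrinciple`, crux `GDTransfer` (stmt-AtomisticToContinuum-9482), line `seeded-continuity`:
# stub `stub_bandEmptinessBdd`, part 2 — pair weights with BOUNDED periodisation, the local terms of one pair

Support file (part 2) of the registered stub `stub_bandEmptinessBdd` of skeleton v6, continuing part 1
(`…SeededPlainFormsBdd`).  Twins (suffix `_bdd`) of the lemmas of `…SeededPlainInteractionPairs` and of the one-pair
section of `…SeededPlainInteractionBracket` in which the hypothesis `IsFiniteContinuous v` is replaced by a bound on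
the periodisation at the given side, `∀ x, v^per_L(x) ≤ C` (which a bounded measurable finite-range profile has:
`exists_bound_periodizedPotential`):
* the pair weights `X ↦ v^per(x_p − x_q)`: finiteness, measurability, the bound `≤ C`, the real periodic interaction
  as the sum of the pair weights, the pair form read in `ℝ≥0∞`, and JENSEN IN A SLOT OF THE PAIR (exact)
  `∫ v^per(x_p − x_q)|h|² = L⁻³‖v‖₁ · ∫|h|²` for continuous `h` flat in a slot `k ∈ {p,q}`;
* for one pair `{p,q}`: rows `i ∉ {p,q}` purely imaginary, entries `i ∈ {p,q} ∌ j` vanishing (adjointness of `b_i`,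
  `P_i^{(n)}` against the bounded measurable pair weight, part 1), and the four local bounds
  `|t₁|, |t₂| ≤ L⁻³‖v‖₁`, `|t₃|, |t₄| ≤ √(L⁻³‖v‖₁)√(∫v^per_pq|ψ|²)` (`pair_local_bounds_bdd`; registered helper statement
  `plainPairsBdd_pair_local_bound`).
All [folklore] (KennedyLiebShastry1988 §2; arXiv:1211.2778 §2; LSSY2005 App. A).
-/

noncomputable section

open MeasureTheory Filter
open scoped ENNReal NNReal ComplexConjugate

namespace Summit.AtomisticToContinuum.BoseEinsteinCondensation.Cruxes.GDTransfer.Seeded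

namespace PlainInteraction

open Literature.MathematicalPhysics.QuantumManyBody.BoseGas
open Summit.AtomisticToContinuum.BoseEinsteinCondensation.Theorems.GaussianDominationCan.Negative
open Summit.AtomisticToContinuum.BoseEinsteinCondensation.Cruxes.GDTransfer.DysonDressedWitness
open Lnss Sector

variable {N m : ℕ} {L : ℝ}

/-! ## The pair weights `v^per(x_p − x_q)` of a profile with bounded periodisation -/

section PairWeightBdd

variable {v : ℝ → ℝ≥0∞} {C : ℝ≥0}

/-- A periodisation bounded by `C` is finite everywhere. [folklore] -/
theorem periodizedPotential_ne_top_bdd (hC : ∀ x, periodizedPotential v L x ≤ C) (x : Space) :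
    periodizedPotential v L x ≠ ⊤ :=
  ne_top_of_le_ne_top ENNReal.coe_ne_top (hC x)

/-- **The real pair weight `X ↦ v^per(x_p − x_q)` is measurable** for a measurable profile. [folklore] -/
theorem measurable_pairWeight (hv : IsRepulsiveFiniteRange v) (L : ℝ) (p q : Fin N) :
    Measurable fun X : Config N => (periodizedPotential v L (X p - X q)).toReal :=
  (Bare.measurable_pairPot hv.1 L p q).ennreal_toReal

/-- **The real pair weight is bounded** by the bound of the periodisation. [folklore] -/
theorem norm_pairWeight_le (hC : ∀ x, periodizedPotential v L x ≤ C) (p q : Fin N) (X : Config N) :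
    ‖(periodizedPotential v L (X p - X q)).toReal‖ ≤ (C : ℝ) := by
  rw [Real.norm_of_nonneg ENNReal.toReal_nonneg]
  exact ENNReal.toReal_le_coe_of_le_coe (hC _)

/-- The real periodic interaction is the sum of the real pair weights (bounded periodisation). [folklore] -/
theorem toReal_periodicInteraction_bdd (hC : ∀ x, periodizedPotential v L x ≤ C) (X : Config N) :
    (periodicInteraction v L X).toReal =
      ∑ p : Fin N, ∑ q ∈ (Finset.univ : Finset (Fin N)).filter (fun q => p < q),
        (periodizedPotential v L (X p - X q)).toReal := by
  unfold periodicInteraction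
  rw [ENNReal.toReal_sum fun p _ => ENNReal.sum_ne_top.2 fun q _ => periodizedPotential_ne_top_bdd hC _]
  exact Finset.sum_congr rfl fun p _ => ENNReal.toReal_sum fun q _ => periodizedPotential_ne_top_bdd hC _

/-- The real pair form read in `ℝ≥0∞`: `ofReal (∫ v^per_{pq}|h|²) = ∫⁻ v^per_{pq} ‖h‖₊²` (bounded periodisation,
continuous `h`). [folklore] -/
theorem ofReal_integral_pairWeight_norm_sq_bdd (hv : IsRepulsiveFiniteRange v)
    (hC : ∀ x, periodizedPotential v L x ≤ C) (p q : Fin N) {h : Config N → ℂ} (hh : Continuous h) :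
    ENNReal.ofReal (∫ X in cellN N L, (periodizedPotential v L (X p - X q)).toReal * ‖h X‖ ^ 2) =
      ∫⁻ X in cellN N L, periodizedPotential v L (X p - X q) * ((‖h X‖₊ : ℝ≥0∞)) ^ 2 := by
  rw [ofReal_integral_weight_norm_sq_bdd (measurable_pairWeight hv L p q) (norm_pairWeight_le hC p q)
    (fun X => ENNReal.toReal_nonneg) hh]
  exact lintegral_congr fun X => by rw [ENNReal.ofReal_toReal (periodizedPotential_ne_top_bdd hC _)]

/-- **Jensen in a slot of the pair (exact)**, bounded periodisation: for continuous `h` FLAT in a slot `k ∈ {p, q}`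
(`p ≠ q`), `∫ v^per(x_p − x_q)|h|² = L⁻³‖v‖₁ · ∫|h|²`. [folklore] -/
theorem integral_pairWeight_norm_sq_flat_bdd {n' : ℕ} (hL : 0 < L) (hv : IsRepulsiveFiniteRange v)
    (hC : ∀ x, periodizedPotential v L x ≤ C) {k p q : Fin (n' + 1)} (hpq : p ≠ q) (hk : k = p ∨ k = q)
    {h : Config (n' + 1) → ℂ} (hh : Continuous h) (hflat : ∀ X z, h (Function.update X k z) = h X) :
    ∫ X in cellN (n' + 1) L, (periodizedPotential v L (X p - X q)).toReal * ‖h X‖ ^ 2 =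
      ((ENNReal.ofReal (L ^ 3))⁻¹ * ∫⁻ x : Space, v ‖x‖).toReal * ∫ X in cellN (n' + 1) L, ‖h X‖ ^ 2 := by
  -- adapted from `integral_pairWeight_norm_sq_flat` (finite continuous profile)
  have hW := Bare.measurable_pairPot hv.1 L p q (N := n' + 1)
  have hflat' : ∀ (X : Config (n' + 1)) (y : Space),
      ((‖h (Function.update X k y)‖₊ : ℝ≥0∞)) ^ 2 = ((‖h X‖₊ : ℝ≥0∞)) ^ 2 := fun X y => by rw [hflat]
  have key : ∫⁻ X in cellN (n' + 1) L, periodizedPotential v L (X p - X q) * ((‖h X‖₊ : ℝ≥0∞)) ^ 2 =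
      (ENNReal.ofReal (L ^ 3))⁻¹ * (∫⁻ x : Space, v ‖x‖) * mass L h := by
    calc ∫⁻ X in cellN (n' + 1) L, periodizedPotential v L (X p - X q) * ((‖h X‖₊ : ℝ≥0∞)) ^ 2
        = ∫⁻ X in cellN (n' + 1) L, ((‖h X‖₊ : ℝ≥0∞)) ^ 2 * periodizedPotential v L (X p - X q) :=
          lintegral_congr fun X => mul_comm _ _
      _ = ∫⁻ X in cellN (n' + 1) L, ((‖h X‖₊ : ℝ≥0∞)) ^ 2 *
            ((ENNReal.ofReal (L ^ 3))⁻¹ * ∫⁻ y in cell L,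
              periodizedPotential v L (Function.update X k y p - Function.update X k y q)) :=
          (Bare.lintegral_cellN_mul_slotAvg hL k (Bare.measurable_nnnorm_sq hh.measurable) hW hflat').symm
      _ = ∫⁻ X in cellN (n' + 1) L, ((‖h X‖₊ : ℝ≥0∞)) ^ 2 *
            ((ENNReal.ofReal (L ^ 3))⁻¹ * ∫⁻ x : Space, v ‖x‖) :=
          lintegral_congr fun X => by rw [Bare.slotAvg_pairPot hL hv.1 hpq hk X]
      _ = (ENNReal.ofReal (L ^ 3))⁻¹ * (∫⁻ x : Space, v ‖x‖) * mass L h := by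
          rw [lintegral_mul_const _ (Bare.measurable_nnnorm_sq hh.measurable), mul_comm]; rfl
  have hI0 : 0 ≤ ∫ X in cellN (n' + 1) L, (periodizedPotential v L (X p - X q)).toReal * ‖h X‖ ^ 2 :=
    integral_nonneg fun X => mul_nonneg ENNReal.toReal_nonneg (sq_nonneg _)
  have hm : (mass L h).toReal = ∫ X in cellN (n' + 1) L, ‖h X‖ ^ 2 := by
    unfold mass
    rw [lintegral_nnnorm_sq_eq _ hh, ENNReal.toReal_ofReal (integral_nonneg fun X => sq_nonneg _)]
  rw [← ENNReal.toReal_ofReal hI0, ofReal_integral_pairWeight_norm_sq_bdd hv hC p q hh, key,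
    ENNReal.toReal_mul, hm]

end PairWeightBdd

/-! ## The local terms of one pair: adjointness rows, vanishing entries, bounds (bounded periodisation) -/

section OnePairBdd

variable {v : ℝ → ℝ≥0∞} {C : ℝ≥0} {n : Fin 3 → ℤ} {p q : Fin (m + 1)} {ψ : Config (m + 1) → ℂ}

/-- **Rows `i ∉ {p,q}` are purely imaginary, first half**: `𝓥_pq(b_iψ, b_jψ) = conj 𝓥_pq(P_i^{(n)}(b_jψ), ψ)`
(adjointness of `b_i` against the pair weight, which is flat in slot `i`). [folklore] -/
theorem pair_t1_eq_conj_t4_bdd (hv : IsRepulsiveFiniteRange v) (hC : ∀ x, periodizedPotential v L x ≤ C)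
    (n : Fin 3 → ℤ) {i : Fin (m + 1)} (hip : p ≠ i) (hiq : q ≠ i) (j : Fin (m + 1)) (hψ : Continuous ψ) :
    ∫ X in cellN (m + 1) L, (((periodizedPotential v L (X p - X q)).toReal : ℝ) : ℂ) *
        (conj (cellWave L n (X i) * cellAvg (m + 1) L i ψ X) * (cellWave L n (X j) * cellAvg (m + 1) L j ψ X)) =
      conj (∫ X in cellN (m + 1) L, (((periodizedPotential v L (X p - X q)).toReal : ℝ) : ℂ) *
        (conj (fourierAvg m L n i (fun Y => cellWave L n (Y j) * cellAvg (m + 1) L j ψ Y) X) * ψ X)) := by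
  rw [form_up_adjoint_bdd n i (measurable_pairWeight hv L p q) (norm_pairWeight_le hC p q)
    (pairWeight_update v L hip hiq) hψ (continuous_up n j hψ), form_conj_symm]

/-- **Rows `i ∉ {p,q}` are purely imaginary, second half**:
`𝓥_pq(P_i^{(n)}ψ, P_j^{(n)}ψ) = conj 𝓥_pq(b_i(P_j^{(n)}ψ), ψ)`. [folklore] -/
theorem pair_t2_eq_conj_t3_bdd (hv : IsRepulsiveFiniteRange v) (hC : ∀ x, periodizedPotential v L x ≤ C)
    (n : Fin 3 → ℤ) {i : Fin (m + 1)} (hip : p ≠ i) (hiq : q ≠ i) (j : Fin (m + 1)) (hψ : Continuous ψ) :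
    ∫ X in cellN (m + 1) L, (((periodizedPotential v L (X p - X q)).toReal : ℝ) : ℂ) *
        (conj (fourierAvg m L n i ψ X) * fourierAvg m L n j ψ X) =
      conj (∫ X in cellN (m + 1) L, (((periodizedPotential v L (X p - X q)).toReal : ℝ) : ℂ) *
        (conj (cellWave L n (X i) * cellAvg (m + 1) L i (fourierAvg m L n j ψ) X) * ψ X)) := by
  rw [form_down_adjoint_bdd n i (measurable_pairWeight hv L p q) (norm_pairWeight_le hC p q)
    (pairWeight_update v L hip hiq) hψ (continuous_fourierAvg n j hψ), form_conj_symm]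

/-- **Entries `i ∈ {p,q}`, `j ∉ {p,q}` vanish, first half**: `𝓥_pq(b_iψ, b_jψ) = 𝓥_pq(b_i(P_j^{(n)}ψ), ψ)`
(adjointness in slot `j` and the mixed commutation `b_i P_j^{(n)} = P_j^{(n)} b_i`). [folklore] -/
theorem pair_t1_eq_t3_bdd (hv : IsRepulsiveFiniteRange v) (hC : ∀ x, periodizedPotential v L x ≤ C)
    (n : Fin 3 → ℤ) {i j : Fin (m + 1)} (hij : i ≠ j) (hjp : p ≠ j) (hjq : q ≠ j) (hψ : Continuous ψ) :
    ∫ X in cellN (m + 1) L, (((periodizedPotential v L (X p - X q)).toReal : ℝ) : ℂ) *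
        (conj (cellWave L n (X i) * cellAvg (m + 1) L i ψ X) * (cellWave L n (X j) * cellAvg (m + 1) L j ψ X)) =
      ∫ X in cellN (m + 1) L, (((periodizedPotential v L (X p - X q)).toReal : ℝ) : ℂ) *
        (conj (cellWave L n (X i) * cellAvg (m + 1) L i (fourierAvg m L n j ψ) X) * ψ X) := by
  rw [form_conj_symm _ (fun X => cellWave L n (X j) * cellAvg (m + 1) L j ψ X),
    form_up_adjoint_bdd n j (measurable_pairWeight hv L p q) (norm_pairWeight_le hC p q)
      (pairWeight_update v L hjp hjq) hψ (continuous_up n i hψ), form_conj_symm _ _ ψ, Complex.conj_conj,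
    ← up_down_comm n hij hψ]

/-- **Entries `i ∈ {p,q}`, `j ∉ {p,q}` vanish, second half**:
`𝓥_pq(P_i^{(n)}ψ, P_j^{(n)}ψ) = 𝓥_pq(P_i^{(n)}(b_jψ), ψ)`. [folklore] -/
theorem pair_t2_eq_t4_bdd (hv : IsRepulsiveFiniteRange v) (hC : ∀ x, periodizedPotential v L x ≤ C)
    (n : Fin 3 → ℤ) {i j : Fin (m + 1)} (hij : i ≠ j) (hjp : p ≠ j) (hjq : q ≠ j) (hψ : Continuous ψ) :
    ∫ X in cellN (m + 1) L, (((periodizedPotential v L (X p - X q)).toReal : ℝ) : ℂ) *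
        (conj (fourierAvg m L n i ψ X) * fourierAvg m L n j ψ X) =
      ∫ X in cellN (m + 1) L, (((periodizedPotential v L (X p - X q)).toReal : ℝ) : ℂ) *
        (conj (fourierAvg m L n i (fun Y => cellWave L n (Y j) * cellAvg (m + 1) L j ψ Y) X) * ψ X) := by
  rw [form_conj_symm _ (fourierAvg m L n j ψ),
    form_down_adjoint_bdd n j (measurable_pairWeight hv L p q) (norm_pairWeight_le hC p q)
      (pairWeight_update v L hjp hjq) hψ (continuous_fourierAvg n i hψ), form_conj_symm _ _ ψ, Complex.conj_conj,
    ← up_down_comm n hij.symm hψ]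

/-- **Jensen bound for a flat unit-mass function** (bounded periodisation): `∫ v^per_{pq}|h|² ≤ L⁻³‖v‖₁` for continuous
`h` flat in a slot of the pair with `∫|h|² ≤ 1`. [folklore] -/
theorem integral_pairWeight_norm_sq_le_bdd (hL : 0 < L) (hv : IsRepulsiveFiniteRange v)
    (hC : ∀ x, periodizedPotential v L x ≤ C) (hpq : p ≠ q) {k : Fin (m + 1)} (hk : k = p ∨ k = q)
    {h : Config (m + 1) → ℂ} (hh : Continuous h) (hflat : ∀ X z, h (Function.update X k z) = h X)
    (h1 : ∫ X in cellN (m + 1) L, ‖h X‖ ^ 2 ≤ 1) :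
    ∫ X in cellN (m + 1) L, (periodizedPotential v L (X p - X q)).toReal * ‖h X‖ ^ 2 ≤
      ((ENNReal.ofReal (L ^ 3))⁻¹ * ∫⁻ x : Space, v ‖x‖).toReal := by
  rw [integral_pairWeight_norm_sq_flat_bdd hL hv hC hpq hk hh hflat]
  exact (mul_le_mul_of_nonneg_left h1 ENNReal.toReal_nonneg).trans_eq (mul_one _)

/-- `∫ v^per_{pq}|b_kψ|² ≤ L⁻³‖v‖₁` for `k ∈ {p,q}` (`|b_kψ| = |P_kψ|` is flat in slot `k`). [folklore] -/
theorem pair_sq_up_le_bdd (hL : 0 < L) (hv : IsRepulsiveFiniteRange v) (hC : ∀ x, periodizedPotential v L x ≤ C)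
    (hpq : p ≠ q) (hψ : Continuous ψ) (hψ1 : ∫ X in cellN (m + 1) L, ‖ψ X‖ ^ 2 ≤ 1) (n : Fin 3 → ℤ) {k : Fin (m + 1)} (hk : k = p ∨ k = q) :
    ∫ X in cellN (m + 1) L, (periodizedPotential v L (X p - X q)).toReal *
        ‖cellWave L n (X k) * cellAvg (m + 1) L k ψ X‖ ^ 2 ≤
      ((ENNReal.ofReal (L ^ 3))⁻¹ * ∫⁻ x : Space, v ‖x‖).toReal := by
  simp only [norm_up]
  exact integral_pairWeight_norm_sq_le_bdd hL hv hC hpq hk (continuous_cellAvg k hψ) (cellAvg_update k ψ)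
    ((integral_norm_sq_cellAvg_le hL k hψ).trans hψ1)

/-- `∫ v^per_{pq}|P_k^{(n)}ψ|² ≤ L⁻³‖v‖₁` for `k ∈ {p,q}`. [folklore] -/
theorem pair_sq_down_le_bdd (hL : 0 < L) (hv : IsRepulsiveFiniteRange v) (hC : ∀ x, periodizedPotential v L x ≤ C)
    (hpq : p ≠ q) (hψ : Continuous ψ) (hψ1 : ∫ X in cellN (m + 1) L, ‖ψ X‖ ^ 2 ≤ 1) (n : Fin 3 → ℤ) {k : Fin (m + 1)} (hk : k = p ∨ k = q) :
    ∫ X in cellN (m + 1) L, (periodizedPotential v L (X p - X q)).toReal * ‖fourierAvg m L n k ψ X‖ ^ 2 ≤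
      ((ENNReal.ofReal (L ^ 3))⁻¹ * ∫⁻ x : Space, v ‖x‖).toReal :=
  integral_pairWeight_norm_sq_le_bdd hL hv hC hpq hk (continuous_fourierAvg n k hψ) (fourierAvg_update n k ψ)
    ((integral_norm_sq_fourierAvg_le hL n k hψ).trans hψ1)

/-- `∫ v^per_{pq}|b_k P_j^{(n)}ψ|² ≤ L⁻³‖v‖₁` for `k ∈ {p,q}`. [folklore] -/
theorem pair_sq_up_down_le_bdd (hL : 0 < L) (hv : IsRepulsiveFiniteRange v) (hC : ∀ x, periodizedPotential v L x ≤ C)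
    (hpq : p ≠ q) (hψ : Continuous ψ) (hψ1 : ∫ X in cellN (m + 1) L, ‖ψ X‖ ^ 2 ≤ 1) (n : Fin 3 → ℤ) {k : Fin (m + 1)} (hk : k = p ∨ k = q) (j : Fin (m + 1)) :
    ∫ X in cellN (m + 1) L, (periodizedPotential v L (X p - X q)).toReal *
        ‖cellWave L n (X k) * cellAvg (m + 1) L k (fourierAvg m L n j ψ) X‖ ^ 2 ≤
      ((ENNReal.ofReal (L ^ 3))⁻¹ * ∫⁻ x : Space, v ‖x‖).toReal := by
  have hF : Continuous (fourierAvg m L n j ψ) := continuous_fourierAvg n j hψ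
  simp only [norm_up]
  exact integral_pairWeight_norm_sq_le_bdd hL hv hC hpq hk (continuous_cellAvg k hF) (cellAvg_update k _)
    (((integral_norm_sq_cellAvg_le hL k hF).trans (integral_norm_sq_fourierAvg_le hL n j hψ)).trans hψ1)

/-- `∫ v^per_{pq}|P_k^{(n)} b_jψ|² ≤ L⁻³‖v‖₁` for `k ∈ {p,q}`. [folklore] -/
theorem pair_sq_down_up_le_bdd (hL : 0 < L) (hv : IsRepulsiveFiniteRange v) (hC : ∀ x, periodizedPotential v L x ≤ C)
    (hpq : p ≠ q) (hψ : Continuous ψ) (hψ1 : ∫ X in cellN (m + 1) L, ‖ψ X‖ ^ 2 ≤ 1) (n : Fin 3 → ℤ) {k : Fin (m + 1)} (hk : k = p ∨ k = q) (j : Fin (m + 1)) :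
    ∫ X in cellN (m + 1) L, (periodizedPotential v L (X p - X q)).toReal *
        ‖fourierAvg m L n k (fun Y => cellWave L n (Y j) * cellAvg (m + 1) L j ψ Y) X‖ ^ 2 ≤
      ((ENNReal.ofReal (L ^ 3))⁻¹ * ∫⁻ x : Space, v ‖x‖).toReal := by
  have hb : Continuous fun Y => cellWave L n (Y j) * cellAvg (m + 1) L j ψ Y := continuous_up n j hψ
  refine integral_pairWeight_norm_sq_le_bdd hL hv hC hpq hk (continuous_fourierAvg n k hb) (fourierAvg_update n k _)
    (((integral_norm_sq_fourierAvg_le hL n k hb).trans ?_).trans hψ1)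
  simp only [norm_up]
  exact integral_norm_sq_cellAvg_le hL j hψ

/-- **The four local bounds** for `i, j ∈ {p,q}` (bounded periodisation): `|𝓥_pq(b_iψ,b_jψ)|,
|𝓥_pq(P_i^{(n)}ψ,P_j^{(n)}ψ)| ≤ L⁻³‖v‖₁` and `|𝓥_pq(b_iP_j^{(n)}ψ, ψ)|, |𝓥_pq(P_i^{(n)}b_jψ, ψ)| ≤
√(L⁻³‖v‖₁) √(∫v^per_{pq}|ψ|²)` (weighted Cauchy–Schwarz and Jensen in a slot of the pair). [folklore] -/
theorem pair_local_bounds_bdd (hL : 0 < L) (hv : IsRepulsiveFiniteRange v) (hC : ∀ x, periodizedPotential v L x ≤ C)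
    (hpq : p ≠ q) (hψ : Continuous ψ) (hψ1 : ∫ X in cellN (m + 1) L, ‖ψ X‖ ^ 2 ≤ 1) (n : Fin 3 → ℤ) {i j : Fin (m + 1)} (hi : i = p ∨ i = q) (hj : j = p ∨ j = q) :
    ‖∫ X in cellN (m + 1) L, (((periodizedPotential v L (X p - X q)).toReal : ℝ) : ℂ) *
        (conj (cellWave L n (X i) * cellAvg (m + 1) L i ψ X) * (cellWave L n (X j) * cellAvg (m + 1) L j ψ X))‖ ≤
        ((ENNReal.ofReal (L ^ 3))⁻¹ * ∫⁻ x : Space, v ‖x‖).toReal ∧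
    ‖∫ X in cellN (m + 1) L, (((periodizedPotential v L (X p - X q)).toReal : ℝ) : ℂ) *
        (conj (fourierAvg m L n i ψ X) * fourierAvg m L n j ψ X)‖ ≤
        ((ENNReal.ofReal (L ^ 3))⁻¹ * ∫⁻ x : Space, v ‖x‖).toReal ∧
    ‖∫ X in cellN (m + 1) L, (((periodizedPotential v L (X p - X q)).toReal : ℝ) : ℂ) *
        (conj (cellWave L n (X i) * cellAvg (m + 1) L i (fourierAvg m L n j ψ) X) * ψ X)‖ ≤
        Real.sqrt ((ENNReal.ofReal (L ^ 3))⁻¹ * ∫⁻ x : Space, v ‖x‖).toReal *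
          Real.sqrt (∫ X in cellN (m + 1) L, (periodizedPotential v L (X p - X q)).toReal * ‖ψ X‖ ^ 2) ∧
    ‖∫ X in cellN (m + 1) L, (((periodizedPotential v L (X p - X q)).toReal : ℝ) : ℂ) *
        (conj (fourierAvg m L n i (fun Y => cellWave L n (Y j) * cellAvg (m + 1) L j ψ Y) X) * ψ X)‖ ≤
        Real.sqrt ((ENNReal.ofReal (L ^ 3))⁻¹ * ∫⁻ x : Space, v ‖x‖).toReal *
          Real.sqrt (∫ X in cellN (m + 1) L, (periodizedPotential v L (X p - X q)).toReal * ‖ψ X‖ ^ 2) := by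
  -- adapted from `pair_local_bounds` (finite continuous profile)
  have hW := measurable_pairWeight hv L p q (N := m + 1)
  have hWb := norm_pairWeight_le hC p q (N := m + 1)
  have hW0 : ∀ X : Config (m + 1), 0 ≤ (periodizedPotential v L (X p - X q)).toReal := fun X =>
    ENNReal.toReal_nonneg
  have hσ : Real.sqrt ((ENNReal.ofReal (L ^ 3))⁻¹ * ∫⁻ x : Space, v ‖x‖).toReal *
      Real.sqrt ((ENNReal.ofReal (L ^ 3))⁻¹ * ∫⁻ x : Space, v ‖x‖).toReal =
        ((ENNReal.ofReal (L ^ 3))⁻¹ * ∫⁻ x : Space, v ‖x‖).toReal := Real.mul_self_sqrt ENNReal.toReal_nonneg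
  have hFc : ∀ k, Continuous (fourierAvg m L n k ψ) := fun k => continuous_fourierAvg n k hψ
  refine ⟨?_, ?_, ?_, ?_⟩
  · refine (norm_form_le_sqrt_mul_sqrt_bdd hW hWb hW0 (continuous_up n i hψ) (continuous_up n j hψ)).trans ?_
    rw [← hσ]
    exact mul_le_mul (Real.sqrt_le_sqrt (pair_sq_up_le_bdd hL hv hC hpq hψ hψ1 n hi))
      (Real.sqrt_le_sqrt (pair_sq_up_le_bdd hL hv hC hpq hψ hψ1 n hj)) (Real.sqrt_nonneg _) (Real.sqrt_nonneg _)
  · refine (norm_form_le_sqrt_mul_sqrt_bdd hW hWb hW0 (hFc i) (hFc j)).trans ?_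
    rw [← hσ]
    exact mul_le_mul (Real.sqrt_le_sqrt (pair_sq_down_le_bdd hL hv hC hpq hψ hψ1 n hi))
      (Real.sqrt_le_sqrt (pair_sq_down_le_bdd hL hv hC hpq hψ hψ1 n hj)) (Real.sqrt_nonneg _) (Real.sqrt_nonneg _)
  · refine (norm_form_le_sqrt_mul_sqrt_bdd hW hWb hW0 (continuous_up n i (hFc j)) hψ).trans ?_
    exact mul_le_mul_of_nonneg_right (Real.sqrt_le_sqrt (pair_sq_up_down_le_bdd hL hv hC hpq hψ hψ1 n hi j))
      (Real.sqrt_nonneg _)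
  · refine (norm_form_le_sqrt_mul_sqrt_bdd hW hWb hW0 (continuous_fourierAvg n i (continuous_up n j hψ)) hψ).trans ?_
    exact mul_le_mul_of_nonneg_right (Real.sqrt_le_sqrt (pair_sq_down_up_le_bdd hL hv hC hpq hψ hψ1 n hi j))
      (Real.sqrt_nonneg _)

end OnePairBdd

end PlainInteraction

/-- **Part 2 of `stub_bandEmptinessBdd` (registered helper statement)**: the third local bound of one pair for a
profile with BOUNDED periodisation — for `p ≠ q`, `i, j ∈ {p,q}`, continuous `ψ` with `∫|ψ|² ≤ 1`,
`|𝓥_pq(b_i P_j^{(n)} ψ, ψ)| ≤ √(L⁻³‖v‖₁) √(∫ v^per_pq |ψ|²)` (weighted Cauchy–Schwarz against the bounded measurable pair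
weight and Jensen in a slot of the pair). [folklore] (KennedyLiebShastry1988 §2; arXiv:1211.2778 §2; LSSY2005 App. A) -/
theorem plainPairsBdd_pair_local_bound : ∀ (v : ℝ → ENNReal) (C : NNReal) (m : ℕ) (L : ℝ), 0 < L → Literature.MathematicalPhysics.QuantumManyBody.BoseGas.IsRepulsiveFiniteRange v → (∀ x : Literature.MathematicalPhysics.QuantumManyBody.BoseGas.Space, Literature.MathematicalPhysics.QuantumManyBody.BoseGas.periodizedPotential v L x ≤ C) → ∀ (n : Fin 3 → ℤ) (p q : Fin (m + 1)), p ≠ q → ∀ (ψ : Literature.MathematicalPhysics.QuantumManyBody.BoseGas.Config (m + 1) → ℂ), Continuous ψ → ∫ X in Literature.MathematicalPhysics.QuantumManyBody.BoseGas.cellN (m + 1) L, ‖ψ X‖ ^ 2 ≤ 1 → ∀ (i j : Fin (m + 1)), (i = p ∨ i = q) → (j = p ∨ j = q) → ‖∫ X in Literature.MathematicalPhysics.QuantumManyBody.BoseGas.cellN (m + 1) L, (((Literature.MathematicalPhysics.QuantumManyBody.BoseGas.periodizedPotential v L (X p - X q)).toReal : ℝ) : ℂ) * ((starRingEnd ℂ)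 (Literature.MathematicalPhysics.QuantumManyBody.BoseGas.cellWave L n (X i) * Summit.AtomisticToContinuum.BoseEinsteinCondensation.Theorems.GaussianDominationCan.Negative.cellAvg (m + 1) L i (Summit.AtomisticToContinuum.BoseEinsteinCondensation.Cruxes.GDTransfer.DysonDressedWitness.fourierAvg m L n j ψ) X) * ψ X)‖ ≤ Real.sqrt ((ENNReal.ofReal (L ^ 3))⁻¹ * ∫⁻ x : Literature.MathematicalPhysics.QuantumManyBody.BoseGas.Space, v ‖x‖).toReal * Real.sqrt (∫ X in Literature.MathematicalPhysics.QuantumManyBody.BoseGas.cellN (m + 1) L, (Literature.MathematicalPhysics.QuantumManyBody.BoseGas.periodizedPotential v L (X p - X q)).toReal * ‖ψ X‖ ^ 2) :=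
  fun _ _ _ _ hL hv hC n _ _ hpq _ hψ hψ1 _ _ hi hj => (PlainInteraction.pair_local_bounds_bdd hL hv hC hpq hψ hψ1 n hi hj).2.2.1

end Summit.AtomisticToContinuum.BoseEinsteinCondensation.Cruxes.GDTransfer.Seeded

end
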